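import Literature.Probability.Percolation.TwoSetExchange
import Summits.CriticalPhenomena.PercolationContinuityZ3.Theorems.PercNearOneGluingNoHeavyLowerTailOwnDisconnection
import HarnessLib

/-!
# `NoHeavyLowerTail` (stmt-CriticalPhenomena-4575) — TRACE-CONDITIONED GLUING, a new four-point inequality:
# `P(o ↔ x | y ↔ b, x ↮ b) + P(o ↔ y | x ↔ b, y ↮ b) ≤ P(o ↔ {x,y} | x ↮ b, y ↮ b)`

Support file (prover prim-gen-kcluster gen 3; `--supports stmt-CriticalPhenomena-4575`).  No definitions, no sorries.
Setting: `μ = prodBernoulli w` on a finite vertex type, observer `o`, sink `b`, relays `x, y`; the TRACE of the sink's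
cluster on `{x, y}` splits into `X = {x ↔ b, y ↮ b}`, `Y = {y ↔ b, x ↮ b}`, `D = {x ↮ b, y ↮ b}`; `D_q = D ∩ {x ↮ y}`.
* `traceGluing_two_mul` (no hypothesis): `μ(D_q)·[μ(o↔x, Y)μ(X)μ(D) + μ(o↔y, X)μ(Y)μ(D)] ≤ μ(D_q)·μ(o↔{x,y}, D)μ(X)μ(Y)`;
* `traceGluing_two` (`μ(D_q) > 0`): `μ(o↔x ∩ Y)/μ(Y) + μ(o↔y ∩ X)/μ(X) ≤ μ((o↔x ∪ o↔y) ∩ D)/μ(D)` — given that exactly the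
  OTHER relay is attached to the sink, the chance that `o` joins a relay, summed over the two relays, is at most the
  chance that `o` joins some relay given that neither is attached.  Order-free, symmetric in `x, y`, equality at `o = x`.
Proof (new): three instances of BHK's two-set exchange (`Literature.…setTwoClusterExchange`, van den Berg–Häggström–Kahn
2006 Thm 1.5/2.1 with vertex sets) — (1) `attach_le_cut`: `μ(o↔x, Y)μ(D_q) ≤ μ(o↔x, D_q)μ(Y)` (`S = {x}`, `T = {b,y}`:
`{x↔o}` increasing in `C_S`, `{b↔y}` increasing / `{b↮y}` decreasing in `C_T`); (2) the same with `x, y` exchanged;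
(3) `join_pair_posCorr`: `μ(o↔{x,y}, D)μ(x↔y, D) ≤ μ(D)μ(o↔{x,y}, x↔y, D)` (`S = {b}`, `T = {x,y}`); (4) given `x ↮ y` the
events `{o↔x}`, `{o↔y}` are disjoint, so (1)+(2) give `Σ ≤ μ(o↔{x,y}, D_q)/μ(D_q) ≤ μ(o↔{x,y}, D)/μ(D)` by (3).
Role: two-relay case of the sink-trace family `Σ_{x∈A} P(o↔x | C_b ∩ A = A∖x) ≤ P(o↔A | A ↮ b)`; with the tripod-exchange
bookkeeping it re-proves worst-first gluing for two relays in the strengthened form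
`P(o↔x | x↮b) + P(o↔y, o↮x | y↮b) ≤ P(o↔{x,y} | x↮b, y↮b)` (`d_x ≥ d_y`).
-/

noncomputable section

namespace Summit.CriticalPhenomena.PercolationContinuityZ3.Theorems

open MeasureTheory Set Literature.Probability.LatticeModels Literature.Probability.Percolation
open scoped Classical

namespace TraceGluing

variable {V : Type*}

open PathExchange (rs)

/-- **Attachment lowers, cutting raises (raw two-set exchange form).**  With `S = {x}`, `T = {b, y}`,
`R = {x ↮ b, x ↮ y}`:  `μ(R ∩ {x↔o} ∩ {b↔y}) · μ(R ∩ {b↮y}) ≤ μ(R ∩ {x↔o} ∩ {b↮y}) · μ(R ∩ {b↔y})`.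
[cite: VandenbergHaggstromKahn2005, Thm. 2.1 (p. 9) at q = 1 with Remark 1 (p. 5) — corollary via `setTwoClusterExchange`, derived in this file] -/
theorem attach_le_cut_set [Fintype V] (w : Sym2 V → unitInterval) (o b x y : V) :
    (prodBernoulli w).real ({ω : BondConfig V | ∀ s ∈ ({x} : Set V), ∀ t ∈ ({b, y} : Set V),
        ¬ (openGraph ω).Reachable s t} ∩ ((openConn x o : Set (BondConfig V)) ∩ openConn b y)) *
      (prodBernoulli w).real ({ω : BondConfig V | ∀ s ∈ ({x} : Set V), ∀ t ∈ ({b, y} : Set V),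
        ¬ (openGraph ω).Reachable s t} ∩ ((openConn b y : Set (BondConfig V))ᶜ ∩ univ)) ≤
    (prodBernoulli w).real ({ω : BondConfig V | ∀ s ∈ ({x} : Set V), ∀ t ∈ ({b, y} : Set V),
        ¬ (openGraph ω).Reachable s t} ∩ ((openConn x o : Set (BondConfig V)) ∩ (openConn b y)ᶜ)) *
      (prodBernoulli w).real ({ω : BondConfig V | ∀ s ∈ ({x} : Set V), ∀ t ∈ ({b, y} : Set V),
        ¬ (openGraph ω).Reachable s t} ∩ ((openConn b y : Set (BondConfig V)) ∩ univ)) := by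
  set S : Set V := {x} with hS
  set T : Set V := {b, y} with hT
  have hxS : x ∈ S := by rw [hS]; exact mem_singleton x
  have hbT : b ∈ T := by rw [hT]; exact mem_insert b {y}
  exact setTwoClusterExchange w S T
    (A₁ := (openConn x o : Set (BondConfig V))) (A₂ := (openConn b y : Set (BondConfig V))ᶜ)
    (B₁ := (openConn b y : Set (BondConfig V))) (B₂ := univ)
    (fun ω ω' hs ht h => TwoSetExchange.typePlus_openConn_of_mem S T hxS o hs ht h)
    (fun ω ω' hs ht h => TwoSetExchange.typePlus_not_openConn_of_mem S T hbT y hs ht h)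
    (fun ω ω' hs ht h => TwoSetExchange.typeMinus_openConn_of_mem S T hbT y hs ht h)
    (fun _ _ _ _ _ => mem_univ _)

/-- **Attachment lowers, cutting raises.**  With `Y = {y↔b, x↮b}` and `D_q = {x↮b, y↮b, x↮y}`:
`μ({o↔x} ∩ Y) · μ(D_q) ≤ μ({o↔x} ∩ D_q) · μ(Y)`, i.e. `P(o↔x | Y) ≤ P(o↔x | D_q)`. [this file] -/
theorem attach_le_cut [Fintype V] (w : Sym2 V → unitInterval) (o b x y : V) :
    (prodBernoulli w).real ((openConn o x : Set (BondConfig V)) ∩ (openConn y b ∩ (openConn x b)ᶜ)) *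
      (prodBernoulli w).real ((openConn x b : Set (BondConfig V))ᶜ ∩ (openConn y b)ᶜ ∩ (openConn x y)ᶜ) ≤
    (prodBernoulli w).real ((openConn o x : Set (BondConfig V)) ∩
        ((openConn x b)ᶜ ∩ (openConn y b)ᶜ ∩ (openConn x y)ᶜ)) *
      (prodBernoulli w).real ((openConn y b : Set (BondConfig V)) ∩ (openConn x b)ᶜ) := by
  have key := attach_le_cut_set w o b x y
  set R : Set (BondConfig V) := {ω : BondConfig V | ∀ s ∈ ({x} : Set V), ∀ t ∈ ({b, y} : Set V),
        ¬ (openGraph ω).Reachable s t} with hR'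
  have hR : ∀ ω : BondConfig V, ω ∈ R ↔ (¬ (openGraph ω).Reachable x b ∧ ¬ (openGraph ω).Reachable x y) := by
    intro ω
    simp only [hR', mem_setOf_eq, mem_insert_iff, mem_singleton_iff, forall_eq_or_imp, forall_eq]
  have e1 : R ∩ ((openConn x o : Set (BondConfig V)) ∩ openConn b y) =
      ((openConn o x : Set (BondConfig V)) ∩ (openConn y b ∩ (openConn x b)ᶜ)) := by
    ext ω
    simp only [mem_inter_iff, mem_compl_iff, hR ω, openConn, mem_setOf_eq]
    constructor
    · rintro ⟨⟨hxb, _⟩, hxo, hby⟩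
      exact ⟨rs hxo, rs hby, hxb⟩
    · rintro ⟨hox, hyb, hxb⟩
      exact ⟨⟨hxb, fun hxy => hxb (hxy.trans hyb)⟩, rs hox, rs hyb⟩
  have e2 : R ∩ ((openConn b y : Set (BondConfig V))ᶜ ∩ univ) =
      ((openConn x b : Set (BondConfig V))ᶜ ∩ (openConn y b)ᶜ ∩ (openConn x y)ᶜ) := by
    ext ω
    simp only [mem_inter_iff, mem_compl_iff, hR ω, openConn, mem_setOf_eq, mem_univ, and_true]
    constructor
    · rintro ⟨⟨hxb, hxy⟩, hby⟩
      exact ⟨⟨hxb, fun hyb => hby (rs hyb)⟩, hxy⟩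
    · rintro ⟨⟨hxb, hyb⟩, hxy⟩
      exact ⟨⟨hxb, hxy⟩, fun hby => hyb (rs hby)⟩
  have e3 : R ∩ ((openConn x o : Set (BondConfig V)) ∩ (openConn b y)ᶜ) =
      ((openConn o x : Set (BondConfig V)) ∩ ((openConn x b)ᶜ ∩ (openConn y b)ᶜ ∩ (openConn x y)ᶜ)) := by
    ext ω
    simp only [mem_inter_iff, mem_compl_iff, hR ω, openConn, mem_setOf_eq]
    constructor
    · rintro ⟨⟨hxb, hxy⟩, hxo, hby⟩
      exact ⟨rs hxo, ⟨hxb, fun hyb => hby (rs hyb)⟩, hxy⟩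
    · rintro ⟨hox, ⟨hxb, hyb⟩, hxy⟩
      exact ⟨⟨hxb, hxy⟩, rs hox, fun hby => hyb (rs hby)⟩
  have e4 : R ∩ ((openConn b y : Set (BondConfig V)) ∩ univ) =
      ((openConn y b : Set (BondConfig V)) ∩ (openConn x b)ᶜ) := by
    ext ω
    simp only [mem_inter_iff, mem_compl_iff, hR ω, openConn, mem_setOf_eq, mem_univ, and_true]
    constructor
    · rintro ⟨⟨hxb, _⟩, hby⟩
      exact ⟨rs hby, hxb⟩
    · rintro ⟨hyb, hxb⟩
      exact ⟨⟨hxb, fun hxy => hxb (hxy.trans hyb)⟩, rs hyb⟩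
  rw [e1, e2, e3, e4] at key
  exact key

/-- **Joining a relay pair is positively correlated with the pair being joined, given both are cut from the
sink (raw two-set exchange form).**  With `S = {b}`, `T = {x, y}`, `D = {b↮x, b↮y}`:
`μ(D ∩ ({x↔o} ∪ {y↔o})) · μ(D ∩ {x↔y}) ≤ μ(D) · μ(D ∩ ({x↔o} ∪ {y↔o}) ∩ {x↔y})`.
[cite: VandenbergHaggstromKahn2005, Thm. 2.1 (p. 9) at q = 1 with Remark 1 (p. 5) — corollary via `setTwoClusterExchange`, derived in this file] -/
theorem join_pair_posCorr_set [Fintype V] (w : Sym2 V → unitInterval) (o b x y : V) :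
    (prodBernoulli w).real ({ω : BondConfig V | ∀ s ∈ ({b} : Set V), ∀ t ∈ ({x, y} : Set V),
        ¬ (openGraph ω).Reachable s t} ∩ (univ ∩ ((openConn x o : Set (BondConfig V)) ∪ openConn y o))) *
      (prodBernoulli w).real ({ω : BondConfig V | ∀ s ∈ ({b} : Set V), ∀ t ∈ ({x, y} : Set V),
        ¬ (openGraph ω).Reachable s t} ∩ (univ ∩ (openConn x y : Set (BondConfig V)))) ≤
    (prodBernoulli w).real ({ω : BondConfig V | ∀ s ∈ ({b} : Set V), ∀ t ∈ ({x, y} : Set V),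
        ¬ (openGraph ω).Reachable s t} ∩ (univ ∩ univ)) *
      (prodBernoulli w).real ({ω : BondConfig V | ∀ s ∈ ({b} : Set V), ∀ t ∈ ({x, y} : Set V),
        ¬ (openGraph ω).Reachable s t} ∩
          (((openConn x o : Set (BondConfig V)) ∪ openConn y o) ∩ openConn x y)) := by
  set S : Set V := {b} with hS
  set T : Set V := {x, y} with hT
  have hxT : x ∈ T := by rw [hT]; exact mem_insert x {y}
  have hyT : y ∈ T := by rw [hT]; exact mem_insert_of_mem x rfl
  exact setTwoClusterExchange w S T
    (A₁ := univ) (A₂ := univ)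
    (B₁ := ((openConn x o : Set (BondConfig V)) ∪ openConn y o)) (B₂ := (openConn x y : Set (BondConfig V)))
    (fun _ _ _ _ _ => mem_univ _) (fun _ _ _ _ _ => mem_univ _)
    (fun ω ω' hs ht h => h.elim (fun h1 => Or.inl (TwoSetExchange.typeMinus_openConn_of_mem S T hxT o hs ht h1))
      (fun h2 => Or.inr (TwoSetExchange.typeMinus_openConn_of_mem S T hyT o hs ht h2)))
    (fun ω ω' hs ht h => TwoSetExchange.typeMinus_openConn_of_mem S T hxT y hs ht h)

/-- **Joining the pair is positively correlated with the pair being joined, given `D = {x↮b, y↮b}`.**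
`μ((o↔x ∪ o↔y) ∩ D) · μ(D ∩ {x↔y}) ≤ μ(D) · μ((o↔x ∪ o↔y) ∩ D ∩ {x↔y})`. [this file] -/
theorem join_pair_posCorr [Fintype V] (w : Sym2 V → unitInterval) (o b x y : V) :
    (prodBernoulli w).real ((((openConn o x : Set (BondConfig V)) ∪ openConn o y)) ∩
        ((openConn x b)ᶜ ∩ (openConn y b)ᶜ)) *
      (prodBernoulli w).real (((openConn x b : Set (BondConfig V))ᶜ ∩ (openConn y b)ᶜ) ∩ openConn x y) ≤
    (prodBernoulli w).real ((openConn x b : Set (BondConfig V))ᶜ ∩ (openConn y b)ᶜ) *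
      (prodBernoulli w).real ((((openConn o x : Set (BondConfig V)) ∪ openConn o y)) ∩
        ((openConn x b)ᶜ ∩ (openConn y b)ᶜ) ∩ openConn x y) := by
  have key := join_pair_posCorr_set w o b x y
  set D' : Set (BondConfig V) := {ω : BondConfig V | ∀ s ∈ ({b} : Set V), ∀ t ∈ ({x, y} : Set V),
        ¬ (openGraph ω).Reachable s t} with hD''
  have hD : ∀ ω : BondConfig V, ω ∈ D' ↔ (¬ (openGraph ω).Reachable b x ∧ ¬ (openGraph ω).Reachable b y) := by
    intro ω
    simp only [hD'', mem_setOf_eq, mem_insert_iff, mem_singleton_iff, forall_eq_or_imp, forall_eq]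
  have f1 : D' ∩ (univ ∩ ((openConn x o : Set (BondConfig V)) ∪ openConn y o)) =
      ((((openConn o x : Set (BondConfig V)) ∪ openConn o y)) ∩ ((openConn x b)ᶜ ∩ (openConn y b)ᶜ)) := by
    ext ω
    simp only [mem_inter_iff, mem_union, mem_compl_iff, hD ω, openConn, mem_setOf_eq, mem_univ, true_and]
    constructor
    · rintro ⟨⟨hbx, hby⟩, h⟩
      exact ⟨h.imp rs rs, fun hxb => hbx (rs hxb), fun hyb => hby (rs hyb)⟩
    · rintro ⟨h, hxb, hyb⟩
      exact ⟨⟨fun hbx => hxb (rs hbx), fun hby => hyb (rs hby)⟩, h.imp rs rs⟩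
  have f2 : D' ∩ (univ ∩ (openConn x y : Set (BondConfig V))) =
      (((openConn x b : Set (BondConfig V))ᶜ ∩ (openConn y b)ᶜ) ∩ openConn x y) := by
    ext ω
    simp only [mem_inter_iff, mem_compl_iff, hD ω, openConn, mem_setOf_eq, mem_univ, true_and]
    constructor
    · rintro ⟨⟨hbx, hby⟩, h⟩
      exact ⟨⟨fun hxb => hbx (rs hxb), fun hyb => hby (rs hyb)⟩, h⟩
    · rintro ⟨⟨hxb, hyb⟩, h⟩
      exact ⟨⟨fun hbx => hxb (rs hbx), fun hby => hyb (rs hby)⟩, h⟩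
  have f3 : D' ∩ (univ ∩ univ) = ((openConn x b : Set (BondConfig V))ᶜ ∩ (openConn y b)ᶜ) := by
    ext ω
    simp only [mem_inter_iff, mem_compl_iff, hD ω, openConn, mem_setOf_eq, mem_univ, and_true]
    constructor
    · rintro ⟨hbx, hby⟩
      exact ⟨fun hxb => hbx (rs hxb), fun hyb => hby (rs hyb)⟩
    · rintro ⟨hxb, hyb⟩
      exact ⟨fun hbx => hxb (rs hbx), fun hby => hyb (rs hby)⟩
  have f4 : D' ∩ ((((openConn x o : Set (BondConfig V)) ∪ openConn y o)) ∩ openConn x y) =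
      ((((openConn o x : Set (BondConfig V)) ∪ openConn o y)) ∩ ((openConn x b)ᶜ ∩ (openConn y b)ᶜ) ∩
        openConn x y) := by
    ext ω
    simp only [mem_inter_iff, mem_union, mem_compl_iff, hD ω, openConn, mem_setOf_eq]
    constructor
    · rintro ⟨⟨hbx, hby⟩, h, hxy⟩
      exact ⟨⟨h.imp rs rs, fun hxb => hbx (rs hxb), fun hyb => hby (rs hyb)⟩, hxy⟩
    · rintro ⟨⟨h, hxb, hyb⟩, hxy⟩
      exact ⟨⟨fun hbx => hxb (rs hbx), fun hby => hyb (rs hby)⟩, h.imp rs rs, hxy⟩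
  rw [f1, f2, f3, f4] at key
  exact key


/-- The symmetric of `D_q`: `{y↮b} ∩ {x↮b} ∩ {y↮x} = {x↮b} ∩ {y↮b} ∩ {x↮y}`. [folklore] -/
theorem cutBoth_sep_comm (b x y : V) :
    ((openConn y b : Set (BondConfig V))ᶜ ∩ (openConn x b)ᶜ ∩ (openConn y x)ᶜ) =
      ((openConn x b : Set (BondConfig V))ᶜ ∩ (openConn y b)ᶜ ∩ (openConn x y)ᶜ) := by
  ext ω
  simp only [mem_inter_iff, mem_compl_iff, openConn, mem_setOf_eq]
  constructor
  · rintro ⟨⟨hyb, hxb⟩, hyx⟩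
    exact ⟨⟨hxb, hyb⟩, fun hxy => hyx (rs hxy)⟩
  · rintro ⟨⟨hxb, hyb⟩, hxy⟩
    exact ⟨⟨hyb, hxb⟩, fun hyx => hxy (rs hyx)⟩

/-- Given `x ↮ y`, the exit through the pair splits into the two single exits:
`μ((o↔x ∪ o↔y) ∩ D ∩ {x↮y}) = μ(o↔x ∩ D_q) + μ(o↔y ∩ D_q)`. [folklore] -/
theorem join_pair_sep_split [Fintype V] (w : Sym2 V → unitInterval) (o b x y : V) :
    (prodBernoulli w).real ((((openConn o x : Set (BondConfig V)) ∪ openConn o y)) ∩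
        ((openConn x b)ᶜ ∩ (openConn y b)ᶜ) ∩ (openConn x y)ᶜ) =
      (prodBernoulli w).real ((openConn o x : Set (BondConfig V)) ∩
          ((openConn x b)ᶜ ∩ (openConn y b)ᶜ ∩ (openConn x y)ᶜ)) +
        (prodBernoulli w).real ((openConn o y : Set (BondConfig V)) ∩
          ((openConn x b)ᶜ ∩ (openConn y b)ᶜ ∩ (openConn x y)ᶜ)) := by
  have hset : ((((openConn o x : Set (BondConfig V)) ∪ openConn o y)) ∩
        ((openConn x b)ᶜ ∩ (openConn y b)ᶜ) ∩ (openConn x y)ᶜ) =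
      ((openConn o x : Set (BondConfig V)) ∩ ((openConn x b)ᶜ ∩ (openConn y b)ᶜ ∩ (openConn x y)ᶜ)) ∪
        ((openConn o y : Set (BondConfig V)) ∩ ((openConn x b)ᶜ ∩ (openConn y b)ᶜ ∩ (openConn x y)ᶜ)) := by
    ext ω
    simp only [mem_inter_iff, mem_union, mem_compl_iff]
    tauto
  have hdisj : Disjoint
      ((openConn o x : Set (BondConfig V)) ∩ ((openConn x b)ᶜ ∩ (openConn y b)ᶜ ∩ (openConn x y)ᶜ))
      ((openConn o y : Set (BondConfig V)) ∩ ((openConn x b)ᶜ ∩ (openConn y b)ᶜ ∩ (openConn x y)ᶜ)) := by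
    rw [Set.disjoint_left]
    rintro ω ⟨hox, _, hxy⟩ ⟨hoy, _⟩
    exact hxy ((rs hox).trans hoy)
  rw [hset, measureReal_union hdisj MeasurableSet.of_discrete]

/-- **Trace-conditioned gluing for two relays, product form (PROVED, no hypothesis).**  With
`X = {x↔b} ∩ {y↮b}`, `Y = {y↔b} ∩ {x↮b}`, `D = {x↮b} ∩ {y↮b}`, `D_q = D ∩ {x↮y}`:
`μ(D_q) · (μ({o↔x} ∩ Y)·μ(X)·μ(D) + μ({o↔y} ∩ X)·μ(Y)·μ(D)) ≤ μ(D_q) · (μ(({o↔x} ∪ {o↔y}) ∩ D)·μ(X)·μ(Y))`.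
[this file] -/
theorem traceGluing_two_mul [Fintype V] (w : Sym2 V → unitInterval) (o b x y : V) :
    (prodBernoulli w).real ((openConn x b : Set (BondConfig V))ᶜ ∩ (openConn y b)ᶜ ∩ (openConn x y)ᶜ) *
      ((prodBernoulli w).real ((openConn o x : Set (BondConfig V)) ∩ (openConn y b ∩ (openConn x b)ᶜ)) *
          (prodBernoulli w).real ((openConn x b : Set (BondConfig V)) ∩ (openConn y b)ᶜ) *
          (prodBernoulli w).real ((openConn x b : Set (BondConfig V))ᶜ ∩ (openConn y b)ᶜ) +
        (prodBernoulli w).real ((openConn o y : Set (BondConfig V)) ∩ (openConn x b ∩ (openConn y b)ᶜ)) *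
          (prodBernoulli w).real ((openConn y b : Set (BondConfig V)) ∩ (openConn x b)ᶜ) *
          (prodBernoulli w).real ((openConn x b : Set (BondConfig V))ᶜ ∩ (openConn y b)ᶜ)) ≤
    (prodBernoulli w).real ((openConn x b : Set (BondConfig V))ᶜ ∩ (openConn y b)ᶜ ∩ (openConn x y)ᶜ) *
      ((prodBernoulli w).real ((((openConn o x : Set (BondConfig V)) ∪ openConn o y)) ∩
          ((openConn x b)ᶜ ∩ (openConn y b)ᶜ)) *
        (prodBernoulli w).real ((openConn x b : Set (BondConfig V)) ∩ (openConn y b)ᶜ) *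
        (prodBernoulli w).real ((openConn y b : Set (BondConfig V)) ∩ (openConn x b)ᶜ)) := by
  set μ := prodBernoulli w with hμ
  -- the players
  set q := μ.real ((openConn x b : Set (BondConfig V))ᶜ ∩ (openConn y b)ᶜ ∩ (openConn x y)ᶜ) with hq
  set c6 := μ.real ((openConn o x : Set (BondConfig V)) ∩ (openConn y b ∩ (openConn x b)ᶜ)) with hc6
  set c8 := μ.real ((openConn o y : Set (BondConfig V)) ∩ (openConn x b ∩ (openConn y b)ᶜ)) with hc8
  set Xv := μ.real ((openConn x b : Set (BondConfig V)) ∩ (openConn y b)ᶜ) with hXv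
  set Yv := μ.real ((openConn y b : Set (BondConfig V)) ∩ (openConn x b)ᶜ) with hYv
  set Dv := μ.real ((openConn x b : Set (BondConfig V))ᶜ ∩ (openConn y b)ᶜ) with hDv
  set N := μ.real ((((openConn o x : Set (BondConfig V)) ∪ openConn o y)) ∩
    ((openConn x b)ᶜ ∩ (openConn y b)ᶜ)) with hN
  set nx := μ.real ((openConn o x : Set (BondConfig V)) ∩
    ((openConn x b)ᶜ ∩ (openConn y b)ᶜ ∩ (openConn x y)ᶜ)) with hnx
  set ny := μ.real ((openConn o y : Set (BondConfig V)) ∩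
    ((openConn x b)ᶜ ∩ (openConn y b)ᶜ ∩ (openConn x y)ᶜ)) with hny
  set m := μ.real (((openConn x b : Set (BondConfig V))ᶜ ∩ (openConn y b)ᶜ) ∩ openConn x y) with hm
  set J := μ.real ((((openConn o x : Set (BondConfig V)) ∪ openConn o y)) ∩
    ((openConn x b)ᶜ ∩ (openConn y b)ᶜ) ∩ openConn x y) with hJ
  -- (1) the two attachment inequalities
  have h1 : c6 * q ≤ nx * Yv := attach_le_cut w o b x y
  have h2 : c8 * q ≤ ny * Xv := by
    have h := attach_le_cut w o b y x
    rw [cutBoth_sep_comm b x y] at h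
    exact h
  -- (2) positive correlation of joining and being joined
  have h3 : N * m ≤ Dv * J := join_pair_posCorr w o b x y
  -- (3) bookkeeping: `Dv = q + m`, `N = J + (nx + ny)`
  have hDsplit : m + q = Dv := by
    have h := OwnDisconnection.split w ((openConn x b : Set (BondConfig V))ᶜ ∩ (openConn y b)ᶜ)
      (openConn x y : Set (BondConfig V))
    rw [show ((openConn x b : Set (BondConfig V))ᶜ ∩ (openConn y b)ᶜ ∩ (openConn x y)ᶜ) =
      ((openConn x b : Set (BondConfig V))ᶜ ∩ (openConn y b)ᶜ) ∩ (openConn x y)ᶜ from rfl] at hq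
    rw [hm, hq, hDv]; exact h
  have hNsplit : J + (nx + ny) = N := by
    have h := OwnDisconnection.split w ((((openConn o x : Set (BondConfig V)) ∪ openConn o y)) ∩
      ((openConn x b)ᶜ ∩ (openConn y b)ᶜ)) (openConn x y : Set (BondConfig V))
    rw [join_pair_sep_split w o b x y] at h
    rw [hJ, hnx, hny, hN]; exact h
  -- nonnegativity
  have hq0 : 0 ≤ q := measureReal_nonneg
  have hX0 : 0 ≤ Xv := measureReal_nonneg
  have hY0 : 0 ≤ Yv := measureReal_nonneg
  have hD0 : 0 ≤ Dv := measureReal_nonneg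
  have hN0 : 0 ≤ N := measureReal_nonneg
  have hnx0 : 0 ≤ nx := measureReal_nonneg
  have hny0 : 0 ≤ ny := measureReal_nonneg
  -- (4) `(nx + ny) · Dv ≤ N · q`
  have h4 : (nx + ny) * Dv ≤ N * q := by
    have : (nx + ny) * Dv = N * q + (N * m - Dv * J) := by rw [← hDsplit, ← hNsplit]; ring
    rw [this]; linarith
  -- (5) assemble
  have hXD : 0 ≤ Xv * Dv := mul_nonneg hX0 hD0
  have hYD : 0 ≤ Yv * Dv := mul_nonneg hY0 hD0
  have hXY : 0 ≤ Xv * Yv := mul_nonneg hX0 hY0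
  calc q * (c6 * Xv * Dv + c8 * Yv * Dv)
      = (c6 * q) * (Xv * Dv) + (c8 * q) * (Yv * Dv) := by ring
    _ ≤ (nx * Yv) * (Xv * Dv) + (ny * Xv) * (Yv * Dv) := by
        exact add_le_add (mul_le_mul_of_nonneg_right h1 hXD) (mul_le_mul_of_nonneg_right h2 hYD)
    _ = ((nx + ny) * Dv) * (Xv * Yv) := by ring
    _ ≤ (N * q) * (Xv * Yv) := mul_le_mul_of_nonneg_right h4 hXY
    _ = q * (N * Xv * Yv) := by ring

/-- **Trace-conditioned gluing for two relays (PROVED).**  With `X = {x↔b} ∩ {y↮b}`, `Y = {y↔b} ∩ {x↮b}`,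
`D = {x↮b} ∩ {y↮b}` and `μ(D ∩ {x↮y}) > 0`:
`μ({o↔x} ∩ Y)/μ(Y) + μ({o↔y} ∩ X)/μ(X) ≤ μ(({o↔x} ∪ {o↔y}) ∩ D)/μ(D)`,
i.e. `P(o ↔ x | y ↔ b, x ↮ b) + P(o ↔ y | x ↔ b, y ↮ b) ≤ P(o ↔ {x, y} | x ↮ b, y ↮ b)`.
(A term with `μ(X) = 0` or `μ(Y) = 0` is `0` by the division convention and also in substance, since then its
numerator vanishes.) [this file] -/
theorem traceGluing_two [Fintype V] (w : Sym2 V → unitInterval) (o b x y : V)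
    (hq : 0 < (prodBernoulli w).real
      ((openConn x b : Set (BondConfig V))ᶜ ∩ (openConn y b)ᶜ ∩ (openConn x y)ᶜ)) :
    (prodBernoulli w).real ((openConn o x : Set (BondConfig V)) ∩ (openConn y b ∩ (openConn x b)ᶜ)) /
        (prodBernoulli w).real ((openConn y b : Set (BondConfig V)) ∩ (openConn x b)ᶜ) +
      (prodBernoulli w).real ((openConn o y : Set (BondConfig V)) ∩ (openConn x b ∩ (openConn y b)ᶜ)) /
        (prodBernoulli w).real ((openConn x b : Set (BondConfig V)) ∩ (openConn y b)ᶜ) ≤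
    (prodBernoulli w).real ((((openConn o x : Set (BondConfig V)) ∪ openConn o y)) ∩
        ((openConn x b)ᶜ ∩ (openConn y b)ᶜ)) /
      (prodBernoulli w).real ((openConn x b : Set (BondConfig V))ᶜ ∩ (openConn y b)ᶜ) := by
  set μ := prodBernoulli w with hμ
  set q := μ.real ((openConn x b : Set (BondConfig V))ᶜ ∩ (openConn y b)ᶜ ∩ (openConn x y)ᶜ) with hqd
  set c6 := μ.real ((openConn o x : Set (BondConfig V)) ∩ (openConn y b ∩ (openConn x b)ᶜ)) with hc6
  set c8 := μ.real ((openConn o y : Set (BondConfig V)) ∩ (openConn x b ∩ (openConn y b)ᶜ)) with hc8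
  set Xv := μ.real ((openConn x b : Set (BondConfig V)) ∩ (openConn y b)ᶜ) with hXv
  set Yv := μ.real ((openConn y b : Set (BondConfig V)) ∩ (openConn x b)ᶜ) with hYv
  set Dv := μ.real ((openConn x b : Set (BondConfig V))ᶜ ∩ (openConn y b)ᶜ) with hDv
  set N := μ.real ((((openConn o x : Set (BondConfig V)) ∪ openConn o y)) ∩
    ((openConn x b)ᶜ ∩ (openConn y b)ᶜ)) with hN
  set nx := μ.real ((openConn o x : Set (BondConfig V)) ∩
    ((openConn x b)ᶜ ∩ (openConn y b)ᶜ ∩ (openConn x y)ᶜ)) with hnx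
  set ny := μ.real ((openConn o y : Set (BondConfig V)) ∩
    ((openConn x b)ᶜ ∩ (openConn y b)ᶜ ∩ (openConn x y)ᶜ)) with hny
  set m := μ.real (((openConn x b : Set (BondConfig V))ᶜ ∩ (openConn y b)ᶜ) ∩ openConn x y) with hm
  set J := μ.real ((((openConn o x : Set (BondConfig V)) ∪ openConn o y)) ∩
    ((openConn x b)ᶜ ∩ (openConn y b)ᶜ) ∩ openConn x y) with hJ
  have h1 : c6 * q ≤ nx * Yv := attach_le_cut w o b x y
  have h2 : c8 * q ≤ ny * Xv := by
    have h := attach_le_cut w o b y x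
    rw [cutBoth_sep_comm b x y] at h
    exact h
  have h3 : N * m ≤ Dv * J := join_pair_posCorr w o b x y
  have hDsplit : m + q = Dv := by
    have h := OwnDisconnection.split w ((openConn x b : Set (BondConfig V))ᶜ ∩ (openConn y b)ᶜ)
      (openConn x y : Set (BondConfig V))
    rw [hm, hqd, hDv]; exact h
  have hNsplit : J + (nx + ny) = N := by
    have h := OwnDisconnection.split w ((((openConn o x : Set (BondConfig V)) ∪ openConn o y)) ∩
      ((openConn x b)ᶜ ∩ (openConn y b)ᶜ)) (openConn x y : Set (BondConfig V))
    rw [join_pair_sep_split w o b x y] at h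
    rw [hJ, hnx, hny, hN]; exact h
  have hX0 : 0 ≤ Xv := measureReal_nonneg
  have hY0 : 0 ≤ Yv := measureReal_nonneg
  have hm0 : 0 ≤ m := measureReal_nonneg
  have hnx0 : 0 ≤ nx := measureReal_nonneg
  have hny0 : 0 ≤ ny := measureReal_nonneg
  have hDpos : 0 < Dv := by rw [← hDsplit]; linarith
  have h4 : (nx + ny) * Dv ≤ N * q := by
    have : (nx + ny) * Dv = N * q + (N * m - Dv * J) := by rw [← hDsplit, ← hNsplit]; ring
    rw [this]; linarith
  -- numerators are dominated by denominators
  have hc6Y : c6 ≤ Yv := by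
    rw [hc6, hYv]; exact measureReal_mono Set.inter_subset_right
  have hc8X : c8 ≤ Xv := by
    rw [hc8, hXv]; exact measureReal_mono Set.inter_subset_right
  -- term by term: `c6/Yv ≤ nx/q`, `c8/Xv ≤ ny/q`
  have t1 : c6 / Yv ≤ nx / q := by
    rcases eq_or_lt_of_le hY0 with hY | hY
    · have hc : c6 = 0 := le_antisymm (by rw [hY]; exact hc6Y) measureReal_nonneg
      rw [hc, zero_div]; exact div_nonneg hnx0 hq.le
    · rw [div_le_div_iff₀ hY hq]; exact h1
  have t2 : c8 / Xv ≤ ny / q := by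
    rcases eq_or_lt_of_le hX0 with hX | hX
    · have hc : c8 = 0 := le_antisymm (by rw [hX]; exact hc8X) measureReal_nonneg
      rw [hc, zero_div]; exact div_nonneg hny0 hq.le
    · rw [div_le_div_iff₀ hX hq]; exact h2
  have t3 : (nx + ny) / q ≤ N / Dv := by
    rw [div_le_div_iff₀ hq hDpos]; exact h4
  calc c6 / Yv + c8 / Xv ≤ nx / q + ny / q := add_le_add t1 t2
    _ = (nx + ny) / q := by rw [add_div]
    _ ≤ N / Dv := t3

end TraceGluing

end Summit.CriticalPhenomena.PercolationContinuityZ3.Theorems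

end
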